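import Mathlib
import Summits.NavierStokesRegularity.NavierStokesRegularity.Theorems.EulerZoomLiouvillePowerGaugeEulerLiouvilleSelfSimilarBernoulliSqueezeSobolevGrowthTools
import HarnessLib

/-!
# «SUPER-FAST CHANNELS SQUEEZE VOLUME TOO FAST» without growth hypotheses, tools: a unit bump and the VELOCITY CUTOFF `φ(‖V‖²/ℓ²)`
# (crux `EulerZoomLiouville.PowerGaugeEulerLiouville` = stmt-NavierStokesRegularity-19832, line `birth`, THE ONE STATEMENT; LEAD's RESIDUE-MEMO-19832-g12 target T3)

Route №10 `EulerZoomLiouville` (NavierStokesRegularity); width seat ns-ezl-w5 g2.  The Sobolev thinness `m = 3+3ρ` of the high Bernoulli sets (LEAD g11/g12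
p636011/p639458, this seat's growth-form twin p640144) uses the LINEAR GROWTH `‖V y‖ ≤ K₁(1+‖y‖)` only to bound `‖W‖ = ‖γy + V‖ = O(L)` on `B_{5L}` in the
pressure-gradient budget `‖∇P′‖ ≤ |1−γ|‖V‖ + ‖DV‖‖W‖`.  OBSERVATION (T3a): far out a high Bernoulli point is FAST (`‖V‖ ≥ a‖y‖`, Sobolev-thin by g11 with no growth
hypothesis) or SLOW AND PRESSURISED (`‖V‖ < a‖y‖`, `P′ > ε‖y‖²`); on the slow set `‖W‖ ≤ (γ + a)‖y‖` holds FOR FREE, so a second, VELOCITY cutoff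
`Φ_L = φ(‖V‖²/ℓ²)` (`ℓ = 2aL`; `φ` a unit bump, `1` on `(−∞,1]`, `0` on `[4,∞)`) inserted into the truncation `χ_L · Φ_L · ψ(P′/(εL²))` localises the gradient
budget to `{‖V‖ < 2ℓ}` where `‖W‖ ≤ (5|γ| + 4a)L` — and costs only `‖∇Φ_L‖ ≤ (4κ/ℓ)‖DV‖`, i.e. `L^{−2}∫_{B_{5L}}‖DV‖² ≲ L^{−1−ρ}`, the same order as before.
Result (`…SqueezeSobolevFree`): EVERY high Bernoulli set of EVERY `C²` class-rate profile is thin with rate `3+3ρ` — no growth hypothesis, no pressure clause.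
This file: the two cutoff tools.

* `Loc.exists_unitSmoothBump` — `φ : ℝ → [0,1]` of class `C¹`, `φ = 1` on `(−∞,1]`, `φ = 0` on `[4,∞)`, `‖φ′‖ ≤ κ`, and `φ′ = 0` on `[4,∞)` (`φ(t) = 1 − ψ((t+2)/6)`).
* `Loc.norm_fderiv_velocityCutoff_le` — for `V ∈ C¹`, `ℓ > 0`: `‖∇[φ(‖V‖²/ℓ²)](y)‖ ≤ (4κ/ℓ)‖DV(y)‖` at EVERY `y` (on `{‖V‖ ≥ 2ℓ}` the derivative vanishes).
* `Loc.velocityCutoff_eq_one` / `Loc.velocityCutoff_eq_zero` / `Loc.fderiv_velocityCutoff_eq_zero` — `Φ = 1` on `{‖V‖ ≤ ℓ}`, `Φ = 0` and `∇Φ = 0` on `{2ℓ ≤ ‖V‖}`.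

HONEST LABEL: tools for ONE dynamical sub-stratum of THE ONE STATEMENT.  WHAT THIS IS NOT: not NS, not E — 19832 is a crux CLASS on the MODEL lattice (E/NS strata)
and stays OPEN; NS regularity is NOT proved. [folklore]
-/

noncomputable section

-- flat `Theorems/<Route><Decl>…` files of one crux share the namespace of the crux (tree convention)
set_option linter.dupNamespace false

open MeasureTheory Set Filter Topology Metric Function InnerProductSpace Module
open scoped RealInnerProductSpace NNReal ENNReal ContDiff

namespace Summit.NavierStokesRegularity.NavierStokesRegularity.Theorems.PowerGaugeEulerLiouville.Loc

open Literature.Analysis Literature.Analysis.FluidPDE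

/-! ### A unit bump -/

/-- **A `C¹` unit bump.**  There are `κ ≥ 0` and `φ : ℝ → [0,1]` of class `C¹` with `φ = 1` on `(−∞, 1]`, `φ = 0` on `[4, ∞)`, `‖φ′‖ ≤ κ` everywhere and
`φ′ = 0` on `[4, ∞)` (`φ(t) = 1 − ψ((t+2)/6)` for the unit step `ψ` of `Loc.exists_unitSmoothStep`; the derivative vanishes at a global maximum of `ψ`). [folklore] -/
theorem exists_unitSmoothBump :
    ∃ κ : ℝ, 0 ≤ κ ∧ ∃ φ : ℝ → ℝ, ContDiff ℝ 1 φ ∧ (∀ t, 0 ≤ φ t) ∧ (∀ t, φ t ≤ 1) ∧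
      (∀ t, t ≤ 1 → φ t = 1) ∧ (∀ t, 4 ≤ t → φ t = 0) ∧ (∀ t, ‖fderiv ℝ φ t‖ ≤ κ) ∧ (∀ t, 4 ≤ t → fderiv ℝ φ t = 0) := by
  obtain ⟨κ, hκ0, ψ, hψ1, hψ0, hψle, hψzero, hψone, hdψ⟩ := exists_unitSmoothStep
  set L6 : ℝ →L[ℝ] ℝ := (6 : ℝ)⁻¹ • ContinuousLinearMap.id ℝ ℝ with hL6
  set A : ℝ → ℝ := fun t => L6 t + (3 : ℝ)⁻¹ with hA
  have hAval : ∀ t, A t = (t + 2) / 6 := fun t => by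
    show (6 : ℝ)⁻¹ • (ContinuousLinearMap.id ℝ ℝ t) + (3 : ℝ)⁻¹ = (t + 2) / 6
    rw [ContinuousLinearMap.id_apply, smul_eq_mul]
    ring
  have hAf : ∀ t, HasFDerivAt A L6 t := fun t => L6.hasFDerivAt.add_const _
  have hA1 : ContDiff ℝ 1 A := L6.contDiff.add contDiff_const
  have hψd : Differentiable ℝ ψ := hψ1.differentiable one_ne_zero
  set φ : ℝ → ℝ := fun t => 1 - ψ (A t) with hφ
  have hcomp : ∀ t, HasFDerivAt φ ((0 : ℝ →L[ℝ] ℝ) - (fderiv ℝ ψ (A t)).comp L6) t :=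
    fun t => (hasFDerivAt_const (1 : ℝ) t).sub ((hψd (A t)).hasFDerivAt.comp t (hAf t))
  have hnormA : ‖L6‖ ≤ 1 := by
    rw [hL6, norm_smul, Real.norm_of_nonneg (by norm_num)]
    have h1 : ‖ContinuousLinearMap.id ℝ ℝ‖ ≤ 1 := ContinuousLinearMap.norm_id_le
    nlinarith [norm_nonneg (ContinuousLinearMap.id ℝ ℝ)]
  refine ⟨κ, hκ0, φ, contDiff_const.sub (hψ1.comp hA1), fun t => ?_, fun t => ?_, fun t ht => ?_, fun t ht => ?_,
    fun t => ?_, fun t ht => ?_⟩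
  · show 0 ≤ 1 - ψ (A t)
    linarith [hψle (A t)]
  · show 1 - ψ (A t) ≤ 1
    linarith [hψ0 (A t)]
  · have h1 : A t ≤ 1 / 2 := by rw [hAval]; linarith
    show 1 - ψ (A t) = 1
    rw [hψzero _ h1, sub_zero]
  · have h1 : 1 ≤ A t := by rw [hAval]; linarith
    show 1 - ψ (A t) = 0
    rw [hψone _ h1, sub_self]
  · rw [(hcomp t).fderiv, zero_sub, norm_neg]
    calc ‖(fderiv ℝ ψ (A t)).comp L6‖
        ≤ ‖fderiv ℝ ψ (A t)‖ * ‖L6‖ := ContinuousLinearMap.opNorm_comp_le _ _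
      _ ≤ κ * 1 := mul_le_mul (hdψ _) hnormA (norm_nonneg _) hκ0
      _ = κ := mul_one κ
  · -- `A t ≥ 1`: `ψ (A t) = 1` is a global maximum of `ψ`, so `ψ′(A t) = 0`
    have h1 : 1 ≤ A t := by rw [hAval]; linarith
    have hmax : IsLocalMax ψ (A t) :=
      Filter.Eventually.of_forall fun x => (hψle x).trans_eq (hψone _ h1).symm
    rw [(hcomp t).fderiv, hmax.fderiv_eq_zero, ContinuousLinearMap.zero_comp, sub_zero]

/-! ### The velocity cutoff `φ(‖V‖²/ℓ²)` -/

variable {V : EuclideanSpace ℝ (Fin 3) → EuclideanSpace ℝ (Fin 3)} {φ : ℝ → ℝ} {κ ℓ : ℝ}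

/-- **Gradient of the velocity cutoff.**  `V ∈ C¹`, `φ ∈ C¹` with `‖φ′‖ ≤ κ` and `φ′ = 0` on `[4,∞)`, `ℓ > 0`: at every `y`,
`‖∇[φ(‖V‖²/ℓ²)](y)‖ ≤ (4κ/ℓ)‖DV(y)‖` (where `‖V y‖ < 2ℓ` the chain rule gives `κ·ℓ⁻²·2‖V y‖‖DV y‖`; elsewhere `φ′(‖V y‖²/ℓ²) = 0`). [folklore] -/
theorem norm_fderiv_velocityCutoff_le (hV : ContDiff ℝ 1 V) (hφ1 : ContDiff ℝ 1 φ) (hκ0 : 0 ≤ κ) (hκ : ∀ t, ‖fderiv ℝ φ t‖ ≤ κ)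
    (hφz : ∀ t, 4 ≤ t → fderiv ℝ φ t = 0) (hℓ : 0 < ℓ) (y : EuclideanSpace ℝ (Fin 3)) :
    ‖fderiv ℝ (fun y => φ ((ℓ ^ 2)⁻¹ * ‖V y‖ ^ 2)) y‖ ≤ 4 * κ / ℓ * ‖fderiv ℝ V y‖ := by
  have hVd : HasFDerivAt V (fderiv ℝ V y) y := (hV.differentiable one_ne_zero y).hasFDerivAt
  have hsq : HasFDerivAt (fun y => ‖V y‖ ^ 2) (2 • (innerSL ℝ (V y)).comp (fderiv ℝ V y)) y := hVd.norm_sq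
  have ht : HasFDerivAt (fun y => (ℓ ^ 2)⁻¹ * ‖V y‖ ^ 2) ((ℓ ^ 2)⁻¹ • (2 • (innerSL ℝ (V y)).comp (fderiv ℝ V y))) y :=
    hsq.const_mul ((ℓ ^ 2)⁻¹)
  have hφd : HasFDerivAt φ (fderiv ℝ φ ((ℓ ^ 2)⁻¹ * ‖V y‖ ^ 2)) ((ℓ ^ 2)⁻¹ * ‖V y‖ ^ 2) :=
    (hφ1.differentiable one_ne_zero _).hasFDerivAt
  have hc : HasFDerivAt (fun y => φ ((ℓ ^ 2)⁻¹ * ‖V y‖ ^ 2))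
      ((fderiv ℝ φ ((ℓ ^ 2)⁻¹ * ‖V y‖ ^ 2)).comp ((ℓ ^ 2)⁻¹ • (2 • (innerSL ℝ (V y)).comp (fderiv ℝ V y)))) y :=
    hφd.comp y ht
  rw [hc.fderiv]
  have hinner : ‖(innerSL ℝ (V y)).comp (fderiv ℝ V y)‖ ≤ ‖V y‖ * ‖fderiv ℝ V y‖ := by
    refine (ContinuousLinearMap.opNorm_comp_le _ _).trans ?_
    rw [innerSL_apply_norm]
  have h2 : ‖(ℓ ^ 2)⁻¹ • (2 • (innerSL ℝ (V y)).comp (fderiv ℝ V y))‖ ≤ (ℓ ^ 2)⁻¹ * (2 * (‖V y‖ * ‖fderiv ℝ V y‖)) := by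
    rw [norm_smul, Real.norm_of_nonneg (by positivity)]
    refine mul_le_mul_of_nonneg_left ?_ (by positivity)
    refine norm_nsmul_le.trans ?_
    push_cast
    exact mul_le_mul_of_nonneg_left hinner (by norm_num)
  by_cases hlt : ‖V y‖ < 2 * ℓ
  · calc ‖(fderiv ℝ φ ((ℓ ^ 2)⁻¹ * ‖V y‖ ^ 2)).comp ((ℓ ^ 2)⁻¹ • (2 • (innerSL ℝ (V y)).comp (fderiv ℝ V y)))‖
        ≤ ‖fderiv ℝ φ ((ℓ ^ 2)⁻¹ * ‖V y‖ ^ 2)‖ * ‖(ℓ ^ 2)⁻¹ • (2 • (innerSL ℝ (V y)).comp (fderiv ℝ V y))‖ :=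
          ContinuousLinearMap.opNorm_comp_le _ _
      _ ≤ κ * ((ℓ ^ 2)⁻¹ * (2 * (‖V y‖ * ‖fderiv ℝ V y‖))) := mul_le_mul (hκ _) h2 (norm_nonneg _) hκ0
      _ ≤ κ * ((ℓ ^ 2)⁻¹ * (2 * (2 * ℓ * ‖fderiv ℝ V y‖))) := by
          gcongr
      _ = 4 * κ / ℓ * ‖fderiv ℝ V y‖ := by
          field_simp
          ring
  · -- `‖V y‖ ≥ 2ℓ`: the bump is flat there
    have h4 : 4 ≤ (ℓ ^ 2)⁻¹ * ‖V y‖ ^ 2 := by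
      rw [not_lt] at hlt
      rw [le_inv_mul_iff₀ (by positivity : (0 : ℝ) < ℓ ^ 2)]
      nlinarith [hlt, hℓ]
    rw [hφz _ h4, ContinuousLinearMap.zero_comp, norm_zero]
    positivity

/-- The velocity cutoff equals `1` where `‖V y‖ ≤ ℓ` (`φ = 1` on `(−∞,1]`). [folklore] -/
theorem velocityCutoff_eq_one (hone : ∀ t, t ≤ 1 → φ t = 1) (hℓ : 0 < ℓ) {y : EuclideanSpace ℝ (Fin 3)} (hy : ‖V y‖ ≤ ℓ) :
    φ ((ℓ ^ 2)⁻¹ * ‖V y‖ ^ 2) = 1 := by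
  apply hone
  rw [inv_mul_le_iff₀ (by positivity : (0 : ℝ) < ℓ ^ 2), mul_one]
  exact pow_le_pow_left₀ (norm_nonneg _) hy 2

/-- The velocity cutoff vanishes where `2ℓ ≤ ‖V y‖` (`φ = 0` on `[4,∞)`). [folklore] -/
theorem velocityCutoff_eq_zero (hzero : ∀ t, 4 ≤ t → φ t = 0) (hℓ : 0 < ℓ) {y : EuclideanSpace ℝ (Fin 3)} (hy : 2 * ℓ ≤ ‖V y‖) :
    φ ((ℓ ^ 2)⁻¹ * ‖V y‖ ^ 2) = 0 := by
  apply hzero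
  rw [le_inv_mul_iff₀ (by positivity : (0 : ℝ) < ℓ ^ 2)]
  nlinarith [hy, hℓ]

/-- The velocity cutoff has zero derivative where `2ℓ ≤ ‖V y‖` (`φ′ = 0` on `[4,∞)`). [folklore] -/
theorem fderiv_velocityCutoff_eq_zero (hV : ContDiff ℝ 1 V) (hφ1 : ContDiff ℝ 1 φ) (hφz : ∀ t, 4 ≤ t → fderiv ℝ φ t = 0) (hℓ : 0 < ℓ)
    {y : EuclideanSpace ℝ (Fin 3)} (hy : 2 * ℓ ≤ ‖V y‖) :
    fderiv ℝ (fun y => φ ((ℓ ^ 2)⁻¹ * ‖V y‖ ^ 2)) y = 0 := by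
  have hVd : HasFDerivAt V (fderiv ℝ V y) y := (hV.differentiable one_ne_zero y).hasFDerivAt
  have ht : HasFDerivAt (fun y => (ℓ ^ 2)⁻¹ * ‖V y‖ ^ 2) ((ℓ ^ 2)⁻¹ • (2 • (innerSL ℝ (V y)).comp (fderiv ℝ V y))) y :=
    hVd.norm_sq.const_mul ((ℓ ^ 2)⁻¹)
  have hφd : HasFDerivAt φ (fderiv ℝ φ ((ℓ ^ 2)⁻¹ * ‖V y‖ ^ 2)) ((ℓ ^ 2)⁻¹ * ‖V y‖ ^ 2) :=
    (hφ1.differentiable one_ne_zero _).hasFDerivAt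
  have h4 : 4 ≤ (ℓ ^ 2)⁻¹ * ‖V y‖ ^ 2 := by
    rw [le_inv_mul_iff₀ (by positivity : (0 : ℝ) < ℓ ^ 2)]
    nlinarith [hy, hℓ]
  have hc : HasFDerivAt (fun y => φ ((ℓ ^ 2)⁻¹ * ‖V y‖ ^ 2))
      ((fderiv ℝ φ ((ℓ ^ 2)⁻¹ * ‖V y‖ ^ 2)).comp ((ℓ ^ 2)⁻¹ • (2 • (innerSL ℝ (V y)).comp (fderiv ℝ V y)))) y :=
    hφd.comp y ht
  rw [hc.fderiv, hφz _ h4, ContinuousLinearMap.zero_comp]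

/-! ### The double truncation `φ(‖U‖²/ℓ²) · ψ(P/s)` of a CIV profile -/

/-- **Gradient of the double truncation — no growth hypothesis.**  `(U, P)` a CIV (3.3) profile (any `γ`, centre `0`); `φ` a unit bump as in
`Loc.exists_unitSmoothBump` (`‖φ′‖ ≤ κ′`, flat on `[4,∞)`), `ψ : ℝ → [0,1]` of class `C¹` with `‖ψ′‖ ≤ κ`; `s, ℓ > 0`.  At every `y` with `‖y‖ ≤ R`:
`‖∇[φ(‖U‖²/ℓ²)·ψ(P/s)](y)‖ ≤ κ s⁻¹|1−γ|·‖U y‖ + (κ s⁻¹(|γ|R + 2ℓ) + 4κ′/ℓ)·‖DU y‖` — on the support of the velocity cutoff `‖U y‖ < 2ℓ`, so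
`‖γy + U y‖ ≤ |γ|R + 2ℓ` bounds the transport factor of `∇P = −(1−γ)U − DU[γy+U]` WITHOUT any growth hypothesis; off the support both the cutoff and its
derivative vanish. [cite: ConstantinIgnatovaVicol2026Putative, §3.1.1 eq. (3.3)] -/
theorem norm_fderiv_doubleTruncation_le {γ : ℝ} {U : EuclideanSpace ℝ (Fin 3) → EuclideanSpace ℝ (Fin 3)} {P : EuclideanSpace ℝ (Fin 3) → ℝ}
    (hprof : IsSelfSimilarEulerProfile γ 0 U P)
    (hφ1 : ContDiff ℝ 1 φ) (hφ0 : ∀ t, 0 ≤ φ t) (hφle : ∀ t, φ t ≤ 1) (hφzero : ∀ t, 4 ≤ t → φ t = 0)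
    {κ' : ℝ} (hκ'0 : 0 ≤ κ') (hdφ : ∀ t, ‖fderiv ℝ φ t‖ ≤ κ') (hdφz : ∀ t, 4 ≤ t → fderiv ℝ φ t = 0)
    {ψ : ℝ → ℝ} (hψ1 : ContDiff ℝ 1 ψ) (hψ0 : ∀ t, 0 ≤ ψ t) (hψle : ∀ t, ψ t ≤ 1) {κ₁ : ℝ} (hdψ : ∀ t, ‖fderiv ℝ ψ t‖ ≤ κ₁)
    {s R : ℝ} (hs : 0 < s) (hℓ : 0 < ℓ) {y : EuclideanSpace ℝ (Fin 3)} (hy : ‖y‖ ≤ R) :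
    ‖fderiv ℝ (fun y => φ ((ℓ ^ 2)⁻¹ * ‖U y‖ ^ 2) * ψ (s⁻¹ • P y)) y‖ ≤
      κ₁ * s⁻¹ * |1 - γ| * ‖U y‖ + (κ₁ * s⁻¹ * (|γ| * R + 2 * ℓ) + 4 * κ' / ℓ) * ‖fderiv ℝ U y‖ := by
  have hκ₁0 : 0 ≤ κ₁ := (norm_nonneg _).trans (hdψ 0)
  have hU1 : ContDiff ℝ 1 U := hprof.contDiff_velocity.of_le (by norm_num)
  have hPc : ContDiff ℝ 1 P := hprof.contDiff_pressure
  set Φ : EuclideanSpace ℝ (Fin 3) → ℝ := fun y => φ ((ℓ ^ 2)⁻¹ * ‖U y‖ ^ 2) with hΦ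
  set g : EuclideanSpace ℝ (Fin 3) → ℝ := fun y => ψ (s⁻¹ • P y) with hg
  have hΦ1 : ContDiff ℝ 1 Φ := hφ1.comp (contDiff_const.mul (hU1.norm_sq ℝ))
  have hg1 : ContDiff ℝ 1 g := hψ1.comp (hPc.const_smul s⁻¹)
  -- the pressure truncation
  have hgd : ‖fderiv ℝ g y‖ ≤ κ₁ * s⁻¹ * ‖fderiv ℝ P y‖ := by
    have hd1 : HasFDerivAt P (fderiv ℝ P y) y := (hPc.differentiable one_ne_zero y).hasFDerivAt
    have hd2 : HasFDerivAt (fun y => s⁻¹ • P y) (s⁻¹ • fderiv ℝ P y) y := hd1.const_smul s⁻¹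
    have hd3 : HasFDerivAt ψ (fderiv ℝ ψ (s⁻¹ • P y)) (s⁻¹ • P y) :=
      (hψ1.differentiable one_ne_zero _).hasFDerivAt
    have hd4 : HasFDerivAt g ((fderiv ℝ ψ (s⁻¹ • P y)).comp (s⁻¹ • fderiv ℝ P y)) y := hd3.comp y hd2
    rw [hd4.fderiv]
    calc ‖(fderiv ℝ ψ (s⁻¹ • P y)).comp (s⁻¹ • fderiv ℝ P y)‖
        ≤ ‖fderiv ℝ ψ (s⁻¹ • P y)‖ * ‖s⁻¹ • fderiv ℝ P y‖ := ContinuousLinearMap.opNorm_comp_le _ _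
      _ ≤ κ₁ * (s⁻¹ * ‖fderiv ℝ P y‖) := by
          rw [norm_smul, Real.norm_of_nonneg (inv_nonneg.2 hs.le)]
          exact mul_le_mul_of_nonneg_right (hdψ _) (by positivity)
      _ = κ₁ * s⁻¹ * ‖fderiv ℝ P y‖ := by ring
  -- the velocity cutoff
  have hΦd : ‖fderiv ℝ Φ y‖ ≤ 4 * κ' / ℓ * ‖fderiv ℝ U y‖ := norm_fderiv_velocityCutoff_le hU1 hφ1 hκ'0 hdφ hdφz hℓ y
  have hdf : fderiv ℝ (fun y => Φ y * g y) y = Φ y • fderiv ℝ g y + g y • fderiv ℝ Φ y :=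
    fderiv_fun_mul (hΦ1.differentiable one_ne_zero y) (hg1.differentiable one_ne_zero y)
  show ‖fderiv ℝ (fun y => Φ y * g y) y‖ ≤ _
  rw [hdf]
  by_cases hUy : ‖U y‖ < 2 * ℓ
  · -- inside the support of the velocity cutoff: `‖γy + U y‖ ≤ |γ| R + 2ℓ` for free
    have hW : ‖γ • y + U y‖ ≤ |γ| * R + 2 * ℓ := by
      calc ‖γ • y + U y‖ ≤ ‖γ • y‖ + ‖U y‖ := norm_add_le _ _
        _ ≤ |γ| * R + 2 * ℓ := by
            rw [norm_smul, Real.norm_eq_abs]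
            exact add_le_add (mul_le_mul_of_nonneg_left hy (abs_nonneg _)) hUy.le
    have hP' : ‖fderiv ℝ P y‖ ≤ |1 - γ| * ‖U y‖ + ‖fderiv ℝ U y‖ * (|γ| * R + 2 * ℓ) :=
      (norm_fderiv_profilePressure_le hprof y).trans
        (add_le_add le_rfl (mul_le_mul_of_nonneg_left hW (norm_nonneg _)))
    calc ‖Φ y • fderiv ℝ g y + g y • fderiv ℝ Φ y‖
        ≤ ‖Φ y • fderiv ℝ g y‖ + ‖g y • fderiv ℝ Φ y‖ := norm_add_le _ _
      _ ≤ ‖fderiv ℝ g y‖ + ‖fderiv ℝ Φ y‖ := by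
          rw [norm_smul, norm_smul, Real.norm_of_nonneg (hφ0 _), Real.norm_of_nonneg (hψ0 _)]
          exact add_le_add (mul_le_of_le_one_left (norm_nonneg _) (hφle _))
            (mul_le_of_le_one_left (norm_nonneg _) (hψle _))
      _ ≤ κ₁ * s⁻¹ * (|1 - γ| * ‖U y‖ + ‖fderiv ℝ U y‖ * (|γ| * R + 2 * ℓ)) + 4 * κ' / ℓ * ‖fderiv ℝ U y‖ :=
          add_le_add (hgd.trans (mul_le_mul_of_nonneg_left hP' (by positivity))) hΦd
      _ = κ₁ * s⁻¹ * |1 - γ| * ‖U y‖ + (κ₁ * s⁻¹ * (|γ| * R + 2 * ℓ) + 4 * κ' / ℓ) * ‖fderiv ℝ U y‖ := by ring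
  · -- outside: the velocity cutoff and its derivative vanish
    have hge : 2 * ℓ ≤ ‖U y‖ := not_lt.1 hUy
    have hΦ0 : Φ y = 0 := velocityCutoff_eq_zero hφzero hℓ hge
    have hdΦ0 : fderiv ℝ Φ y = 0 := fderiv_velocityCutoff_eq_zero hU1 hφ1 hdφz hℓ hge
    rw [hΦ0, hdΦ0, zero_smul, smul_zero, add_zero, norm_zero]
    have hR : 0 ≤ |γ| * R + 2 * ℓ := by
      have : 0 ≤ R := (norm_nonneg _).trans hy
      positivity
    positivity

end Summit.NavierStokesRegularity.NavierStokesRegularity.Theorems.PowerGaugeEulerLiouville.Loc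

end
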